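import Literature.Computability.Complexity.Promise
import Literature.Computability.Complexity.PromiseBPPClosure
import Literature.Computability.Complexity.Oracle
import Literature.Computability.Complexity.OracleProofs
import HarnessLib

/-!
# Cook reductions among promise problems (Goldreich 2006, §1.2, Def. 3)

Trunk `CplxCore` (Literature/Computability/Complexity), namespace `Literature.Computability.Complexity.PromiseProblem`.
Companion of `Promise.lean` (Karp reductions of promise problems, `PromiseProblem.PolyTimeReducible`)
and `Oracle.lean` (Cook reductions of languages, `PolyTimeTuringReducible`, in the transcript
model `OracleAlg` of oracle computation).

**Source.** O. Goldreich, *On promise problems: a survey*, in: Theoretical Computer Science —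
Essays in Memory of Shimon Even, LNCS 3895 (2006) 254–290, §1.2, Definition 3 (p. 257–258;
p. 283–284 of the Festschrift volume): "The promise problem `Π = (Π_YES, Π_NO)` is
Cook-reducible to the promise problem `Π' = (Π'_YES, Π'_NO)` if there exists a polynomial-time
oracle machine `M` such that: for every `x ∈ Π_YES` it holds that `M^{Π'}(x) = 1`; for every
`x ∈ Π_NO` it holds that `M^{Π'}(x) = 0`; where queries to `Π'` that satisfy its promise are
answered correctly and other queries may be answered arbitrarily. Alternatively: for every
function `σ : {0,1}* → {0,1,⊥}` with `σ(y) = 1` for `y ∈ Π'_YES` and `σ(y) = 0` for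
`y ∈ Π'_NO`, `M^σ(x) = 1` for every `x ∈ Π_YES` and `M^σ(x) = 0` for every `x ∈ Π_NO`."
And the remark following it (p. 258): "a reduction to a promise problem should yield the
correct answer regardless of how one answers queries that violate the promise. We stress that
the standard meaning of a reduction is preserved: if `Π` is Cook-reducible to a promise problem
in P (or in BPP) then `Π` is in P (resp., in BPP)."

## Contents

* `PromiseProblem.SolvedBy Q O` — the oracle `O : {0,1}* → {0,1}*` is one of Goldreich's
  functions `σ` for `Q`: answers of length `≤ 1` (`[true] = 1`, `[false] = 0`, `[] = ⊥`),
  `[true]` on YES instances and `[false]` on NO instances of `Q`.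
* `PromiseProblem.CookReducible Q₁ Q₂` — Definition 3 in the alternative formulation, in the
  transcript model of `Oracle.lean` and with the resource conventions of `PRel` there: an oracle
  algorithm `M : OracleAlg Bool` with polynomial-time step function and a polynomial `q` such
  that for EVERY oracle `O` solving `Q₂` and every instance `x` on the promise of `Q₁`, the run
  of `M` with `O` on `x` outputs the right bit within `q |x|` rounds, asking queries of length
  `≤ q |x|`.
* PROVED API: `SolvedBy.disjoint`, `solvedBy_ofLanguage` / `solvedBy_ofLanguage_iff` (for a
  language the only solving oracle is `Oracle.ofLanguage`), `exists_solvedBy` (a disjoint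
  problem has one), `cookReducible_ofLanguage_iff` (on languages, `CookReducible` is exactly
  `≤ᵀₚ`), `CookReducible.of_subset` / `CookReducible.mono_right` (special cases), and
  `PolyTimeReducible.cookReducible` (a Karp reduction of promise problems is a one-query Cook
  reduction — via `karpAlg` and `isPolyTime_karpAlg` of `OracleProofs.lean`).
* NAMED FACTS (the remark, nothing asserted): `mem_PromiseP_of_cookReducible`,
  `mem_PromiseBPP'_of_cookReducible`; and the PROVED corollary
  `mem_PromiseBPP'_of_polyTimeReducible_of_cook`: the Cook form implies the Karp form
  `mem_PromiseBPP'_of_polyTimeReducible` recorded in `PromiseBPPClosure.lean`.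

## Design notes

* Oracles answer with strings (`Oracle = List Bool → List Bool`); Goldreich's three answers
  `1, 0, ⊥` are `[true], [false], []`, whence the clause `|O y| ≤ 1` in `SolvedBy`. For a
  language `L` (trivial promise) `SolvedBy (ofLanguage L) O ↔ O = Oracle.ofLanguage L`
  (Mathlib's `encodeBool b = [b]`), so that `CookReducible` restricts to `PolyTimeTuringReducible`
  on languages (`cookReducible_ofLanguage_iff`).
* As in `PRel`, the round budget and the query-length bound are part of the definition (the
  transcript model has no global clock; see the adequacy discussion in `Oracle.lean`); they are
  only required on the promise of `Q₁`, where Definition 3 requires anything at all.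

## References

* O. Goldreich, On promise problems: a survey, LNCS 3895 (2006) 254–290, §1.2, Def. 3 and the
  remark following it [Goldreich2006].
* R. E. Ladner, N. A. Lynch, A. L. Selman, A comparison of polynomial time reducibilities,
  Theoret. Comput. Sci. 1 (1975) 103–123, §2 (Karp ⇒ Cook) [LadnerLynchSelman1975].
-/

noncomputable section

namespace Literature.Computability.Complexity

open _root_.Computability Polynomial

open scoped Notation

namespace PromiseProblem

/-! ### Oracles solving a promise problem -/

/-- `Q.SolvedBy O`: the oracle `O` solves the promise problem `Q` in the sense of Goldreich's
functions `σ : {0,1}* → {0,1,⊥}` consistent with `Q` — every answer is one of `[true]` (`1`),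
`[false]` (`0`), `[]` (`⊥`); YES instances are answered `[true]`, NO instances `[false]`, and
instances off the promise arbitrarily. [cite: Goldreich2006, §1.2 Def. 3 (alternative formulation)] -/
def SolvedBy (Q : PromiseProblem) (O : Oracle) : Prop :=
  (∀ y, (O y).length ≤ 1) ∧ (∀ y ∈ Q.yes, O y = [true]) ∧ (∀ y ∈ Q.no, O y = [false])

/-- A promise problem solved by some oracle has disjoint YES and NO sets. [cite: Goldreich2006, §1.2 Def. 1] -/
theorem SolvedBy.disjoint {Q : PromiseProblem} {O : Oracle} (h : Q.SolvedBy O) : Q.Disjoint := by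
  refine Set.disjoint_left.2 fun y hy hn => ?_
  have h1 := h.2.1 y hy
  rw [h.2.2 y hn] at h1
  simp at h1

/-- The oracle of a language solves it as a promise problem with trivial promise. [cite: Goldreich2006, §1.2 Def. 3] -/
theorem solvedBy_ofLanguage (L : Language Bool) : (ofLanguage L).SolvedBy (Oracle.ofLanguage L) := by
  refine ⟨fun y => by simp [encodeBool], fun y hy => ?_, fun y hy => ?_⟩
  · have hy' : y ∈ L := hy
    rw [Oracle.ofLanguage_apply, (Set.mem_iff_boolIndicator _ _).1 hy']
    rfl
  · have hy' : y ∉ L := hy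
    rw [Oracle.ofLanguage_apply, (Set.notMem_iff_boolIndicator _ _).1 hy']
    rfl

/-- For a language (trivial promise) the only solving oracle is the oracle of the language.
[cite: Goldreich2006, §1.2 Def. 3] -/
theorem solvedBy_ofLanguage_iff (L : Language Bool) (O : Oracle) :
    (ofLanguage L).SolvedBy O ↔ O = Oracle.ofLanguage L := by
  refine ⟨fun h => funext fun y => ?_, fun h => h ▸ solvedBy_ofLanguage L⟩
  by_cases hy : y ∈ L
  · rw [h.2.1 y hy, Oracle.ofLanguage_apply, (Set.mem_iff_boolIndicator _ _).1 hy]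
    rfl
  · rw [h.2.2 y hy, Oracle.ofLanguage_apply, (Set.notMem_iff_boolIndicator _ _).1 hy]
    rfl

/-- A promise problem with disjoint YES and NO sets is solved by some oracle (answer `[y ∈ YES]`).
[cite: Goldreich2006, §1.2 Def. 3] -/
theorem exists_solvedBy {Q : PromiseProblem} (h : Q.Disjoint) : ∃ O, Q.SolvedBy O := by
  refine ⟨Oracle.ofLanguage Q.yes, fun y => by simp [encodeBool], fun y hy => ?_, fun y hy => ?_⟩
  · rw [Oracle.ofLanguage_apply, (Set.mem_iff_boolIndicator _ _).1 hy]
    rfl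
  · have hy' : y ∉ Q.yes := fun h' => Set.disjoint_left.1 h h' hy
    rw [Oracle.ofLanguage_apply, (Set.notMem_iff_boolIndicator _ _).1 hy']
    rfl

/-- Solving a problem solves its special cases: if `Q.yes ⊆ Q'.yes` and `Q.no ⊆ Q'.no` then an
oracle solving `Q'` solves `Q` (`≤` is inclusion of languages). [cite: Goldreich2006, §1.3 (special case of a promise problem)] -/
theorem SolvedBy.of_subset {Q Q' : PromiseProblem} {O : Oracle} (h : Q'.SolvedBy O)
    (hy : Q.yes ≤ Q'.yes) (hn : Q.no ≤ Q'.no) : Q.SolvedBy O :=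
  ⟨h.1, fun y hy' => h.2.1 y (hy hy'), fun y hn' => h.2.2 y (hn hn')⟩

/-! ### Cook reductions (Goldreich 2006, Def. 3) -/

/-- `Q₁.CookReducible Q₂`: the promise problem `Q₁` is Cook-reducible to the promise problem `Q₂`
(**Goldreich 2006, §1.2, Def. 3**, alternative formulation): there are an oracle algorithm `M`
(transcript model `OracleAlg Bool` of `Oracle.lean`) with polynomial-time step function
(`OracleAlg.IsPolyTime`) and a polynomial `q` such that for every oracle `O` solving `Q₂`
(`SolvedBy`: correct on the promise of `Q₂`, arbitrary `1/0/⊥` answers elsewhere) and every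
`x`: if `x ∈ Q₁.yes` then `M` with oracle `O` outputs `true` on `x` within `q |x|` rounds, and if
`x ∈ Q₁.no` it outputs `false` within `q |x|` rounds, in both cases asking only queries of length
`≤ q |x|` (the resource conventions of `PRel`). Nothing is required off the promise of `Q₁`.
[cite: Goldreich2006, §1.2 Def. 3] -/
def CookReducible (Q₁ Q₂ : PromiseProblem) : Prop :=
  ∃ M : OracleAlg Bool, M.IsPolyTime encodingBoolBool ∧ ∃ q : Polynomial ℕ,
    ∀ O : Oracle, Q₂.SolvedBy O → ∀ x : List Bool,
      (x ∈ Q₁.yes → M.run O (q.eval x.length) x = some true ∧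
          ∀ y ∈ M.queries O (q.eval x.length) x, y.length ≤ q.eval x.length) ∧
      (x ∈ Q₁.no → M.run O (q.eval x.length) x = some false ∧
          ∀ y ∈ M.queries O (q.eval x.length) x, y.length ≤ q.eval x.length)

/-- **On languages, Cook reducibility of promise problems is polynomial-time Turing
reducibility**: `(ofLanguage L₁).CookReducible (ofLanguage L₂) ↔ L₁ ≤ᵀₚ L₂` (the only oracle
solving `ofLanguage L₂` is `Oracle.ofLanguage L₂`, and the promise of `ofLanguage L₁` is
everything). [cite: Goldreich2006, §1.2 Def. 3 ("extends the most basic type of reductions")] -/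
theorem cookReducible_ofLanguage_iff (L₁ L₂ : Language Bool) :
    (ofLanguage L₁).CookReducible (ofLanguage L₂) ↔ L₁ ≤ᵀₚ L₂ := by
  constructor
  · rintro ⟨M, hM, q, h⟩
    refine ⟨M, hM, q, fun x => ?_⟩
    have hx := h (Oracle.ofLanguage L₂) (solvedBy_ofLanguage L₂) x
    by_cases hmem : x ∈ L₁
    · obtain ⟨hrun, hq⟩ := hx.1 hmem
      exact ⟨by rw [hrun, (Set.mem_iff_boolIndicator _ _).1 hmem], hq⟩
    · obtain ⟨hrun, hq⟩ := hx.2 hmem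
      exact ⟨by rw [hrun, (Set.notMem_iff_boolIndicator _ _).1 hmem], hq⟩
  · rintro ⟨M, hM, q, h⟩
    refine ⟨M, hM, q, fun O hO x => ?_⟩
    rw [(solvedBy_ofLanguage_iff L₂ O).1 hO]
    refine ⟨fun hmem => ⟨?_, (h x).2⟩, fun hmem => ⟨?_, (h x).2⟩⟩
    · have hmem' : x ∈ L₁ := hmem
      rw [(h x).1, (Set.mem_iff_boolIndicator _ _).1 hmem']
    · have hmem' : x ∉ L₁ := hmem
      rw [(h x).1, (Set.notMem_iff_boolIndicator _ _).1 hmem']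

/-- A Cook reduction of `Q₁` to `Q₂` is a Cook reduction of every special case of `Q₁`
(`Q₁'.yes ⊆ Q₁.yes`, `Q₁'.no ⊆ Q₁.no`) to `Q₂`. [cite: Goldreich2006, §1.3 (special case of a promise problem)] -/
theorem CookReducible.of_subset {Q₁ Q₁' Q₂ : PromiseProblem} (h : Q₁.CookReducible Q₂)
    (hy : Q₁'.yes ≤ Q₁.yes) (hn : Q₁'.no ≤ Q₁.no) : Q₁'.CookReducible Q₂ := by
  obtain ⟨M, hM, q, h⟩ := h
  exact ⟨M, hM, q, fun O hO x => ⟨fun hx => (h O hO x).1 (hy hx), fun hx => (h O hO x).2 (hn hx)⟩⟩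

/-- A Cook reduction of `Q₁` to `Q₂` is a Cook reduction of `Q₁` to every problem of which `Q₂` is
a special case (`Q₂.yes ⊆ Q₂'.yes`, `Q₂.no ⊆ Q₂'.no`): an oracle solving `Q₂'` solves `Q₂`.
[cite: Goldreich2006, §1.3 (special case of a promise problem)] -/
theorem CookReducible.mono_right {Q₁ Q₂ Q₂' : PromiseProblem} (h : Q₁.CookReducible Q₂)
    (hy : Q₂.yes ≤ Q₂'.yes) (hn : Q₂.no ≤ Q₂'.no) : Q₁.CookReducible Q₂' := by
  obtain ⟨M, hM, q, h⟩ := h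
  exact ⟨M, hM, q, fun O hO x => h O (hO.of_subset hy hn) x⟩

/-- **A Karp reduction of promise problems is a (one-query) Cook reduction**: given the
polynomial-time `f` (machine `M`, time `p`) mapping YES to YES and NO to NO, the oracle
algorithm `karpAlg f` of `OracleProofs.lean` asks the single query `f x` (of length
`≤ |x| + D p(|x|)`, `D` the push bound of `M`) and outputs the answer bit, which any oracle
solving `Q₂` gives correctly on the promise of `Q₁`; round and query budget `X + D p + 2`.
[Goldreich 2006, §1.2 Def. 3 (Karp and Cook reductions); Ladner–Lynch–Selman 1975, p. 104 and
§2, Prop. 2.1 (`≤ᴾₘ ⇒ ≤ᴾᴛ`)] [cite: Goldreich2006, §1.2 Def. 3] -/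
theorem PolyTimeReducible.cookReducible {Q₁ Q₂ : PromiseProblem} (h : Q₁.PolyTimeReducible Q₂) :
    Q₁.CookReducible Q₂ := by
  obtain ⟨f, hf, hyes, hno⟩ := h
  obtain ⟨p, M, hM⟩ := id hf
  refine ⟨karpAlg f, isPolyTime_karpAlg hf, X + C (TM2Comp.machinePushBound M.tm) * p + 2,
    fun O hO x => ?_⟩
  have hq : (X + C (TM2Comp.machinePushBound M.tm) * p + 2 : Polynomial ℕ).eval x.length =
      (x.length + TM2Comp.machinePushBound M.tm * p.eval x.length) + 2 := by
    simp [eval_add, eval_mul, eval_X]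
  rw [hq, run_karpAlg, queries_karpAlg]
  have hlen : ∀ y ∈ [f x], y.length ≤ x.length + TM2Comp.machinePushBound M.tm * p.eval x.length + 2 := by
    intro y hy
    rw [List.mem_singleton] at hy
    subst hy
    have := (hM x).length_le
    simp only [id] at this
    omega
  refine ⟨fun hx => ⟨?_, hlen⟩, fun hx => ⟨?_, hlen⟩⟩
  · rw [hO.2.1 (f x) (hyes hx)]
    rfl
  · rw [hO.2.2 (f x) (hno hx)]
    rfl

/-- Every promise problem Cook-reduces to itself (one query: the input; no disjointness
hypothesis is needed — a problem with meeting YES and NO sets has no solving oracle, so the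
condition is vacuous for it). [cite: Goldreich2006, §1.2 Def. 3] -/
theorem CookReducible.refl (Q : PromiseProblem) : Q.CookReducible Q :=
  (PolyTimeReducible.refl Q).cookReducible

/-! ### The remark after Definition 3: named facts -/

/-- NAMED FACT (**Goldreich 2006, §1.2, remark after Def. 3**, the `P` case; nothing is asserted):
"if `Π` is Cook-reducible to a promise problem in P then `Π` is in P" (p. 258, restated p. 259:
"a Cook-reduction to a promise problem in P does guarantee that the reduced problem is in P").
With `PromiseP = promiseLift P`: run the reduction with the oracle of a separating language
`L ∈ P` of `Q₂` (it solves `Q₂`); the accepted inputs form a language of `P^L = P` separating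
`Q₁`. (Machine-level content: composition of polynomial-time machines, cf. `PRel_empty`,
`mem_PRel_of_polyTimeTuringReducible` of `Oracle.lean`.) [cite: Goldreich2006, §1.2 remark after Def. 3 (p. 258)] -/
def mem_PromiseP_of_cookReducible : Prop :=
  ∀ Q₁ Q₂ : PromiseProblem, Q₁.CookReducible Q₂ → Q₂ ∈ PromiseP → Q₁ ∈ PromiseP

/-- NAMED FACT (**Goldreich 2006, §1.2, remark after Def. 3**, the `BPP` case; nothing is
asserted): "if `Π` is Cook-reducible to a promise problem in BPP then `Π` is in BPP" (p. 258),
for the textbook class promise-BPP (`PromiseBPP'`; Goldreich's Def. 2, BPP bullet). Standard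
proof: reduce the error of the promise-BPP decider for `Q₂` below `1/(3 q(|x|))` by majority vote
over independent runs, answer the `≤ q(|x|)` queries of the reduction with it using fresh coins
for each NEW query and memoising the answers (a repeated query gets its recorded answer, so that
every run is the run of the reduction against ONE deterministic oracle `σ`); on-promise queries
are then all answered correctly except with probability `≤ 1/3` (union bound), off-promise
queries receive some fixed `0/1` answer, and against every such `σ` conforming with `Q₂` the
reduction is correct by definition of `CookReducible`; the total coin length is polynomial
because the queries have length `≤ q(|x|)`. [cite: Goldreich2006, §1.2 remark after Def. 3 (p. 258)] -/
def mem_PromiseBPP'_of_cookReducible : Prop :=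
  ∀ Q₁ Q₂ : PromiseProblem, Q₁.CookReducible Q₂ → Q₂ ∈ PromiseBPP' → Q₁ ∈ PromiseBPP'

/-- The Cook form of the closure of promise-BPP implies the Karp form recorded in
`PromiseBPPClosure.lean` (`mem_PromiseBPP'_of_polyTimeReducible`), since Karp reductions are Cook
reductions (`PolyTimeReducible.cookReducible`). [cite: Goldreich2006, §1.2 remark after Def. 3 (p. 258)] -/
theorem mem_PromiseBPP'_of_polyTimeReducible_of_cook (h : mem_PromiseBPP'_of_cookReducible) :
    mem_PromiseBPP'_of_polyTimeReducible :=
  fun Q₁ Q₂ h₁₂ h₂ => h Q₁ Q₂ h₁₂.cookReducible h₂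

end PromiseProblem

end Literature.Computability.Complexity

end
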